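import Summits.ResolutionOfSingularities.ResolutionOfSingularities.Theorems.EquisingularLiftEquisingularLiftNatThreeLinesChartModel
import Summits.ResolutionOfSingularities.ResolutionOfSingularities.Theorems.EquisingularLiftEquisingularLiftNatThreeLinesLinearChange
import Summits.ResolutionOfSingularities.ResolutionOfSingularities.Theorems.EquisingularLiftEquisingularLiftNatDirStepUnobsHostChange
import Summits.ResolutionOfSingularities.ResolutionOfSingularities.Theorems.EquisingularLiftEquisingularLiftNatSpecimenSteinerPointStep
import Summits.ResolutionOfSingularities.ResolutionOfSingularities.Theorems.RadicialJungCleanModelsSufficeGameEndStrata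
import HarnessLib

/-!
# [OURS · L1 W4.5(b) · EL♮(3) · nose residue, (c) file 5c] ★★ STEINER'S NOSE IS UNOBSTRUCTED:
# `DirStepUnobs F₂ univ (⋃ i : Fin 3, vertexLineStrict υ i)` for ANY blowing up `υ` of the vertex of `ℙ³_k` (`k` infinite)

Crux chain w45b, child EL♮(3) = stmt-ResolutionOfSingularities-20148; WIDTH seat res-L1-w45b-nose-w3 g3 (D-0157 DOOR 1), brick (c) = the ×3 UNION
certificate for res-L1-w45b-nose-w2's «Steiner ∈ ν2» assembly ✓ `Steiner.noseHypPointsFirstBTriplePrime_of_unobs_of_final` (its hypothesis `hunobs`,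
BY TYPE), after res-type-027's recipe of record (STATUS 2026-08-28T19:33Z): ONE socket call of res-L1-w45b-nose-w1's producer ✓
`dirStepUnobs_univ_of_charts` on the two affine charts `c₀(Spec C₀) ∩ D(ℓ)` and `b⁻¹D₊(x₀) ∩ D(ℓ)` of a blowing up `b` of the vertex (after the
linear change ✓ `ThreeLines.exists_linearAut` that puts the three lines into `V₊(x₁ − q₁x₀, x₂ − q₂x₀)`, `q ∈ {(0,0),(1,0),(0,1)}`), generators 027's
✓ CI3 `f = u₁(u₁−1)`, `g = u₂(u₂−1+2u₁)` read through the model `k[u₁,u₂][T]` (✓ `chartRingEquiv_sigma_A/B`), transition matrix `1`, Laurent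
splitting ✓ `exists_split_mod` with coefficients in `k[u₁,u₂][1/ℓ]` (✓ `exists_polynomial_eq_localization`). `--supports stmt-ResolutionOfSingularities-20148
--as helper`. OURS; NOT a statement of any manuscript; AI-written, weaker than expert review. No `sorry`; standard axioms; DEF-FREE. EL♮(3) is NOT proved
by this file; resolution of singularities in positive characteristic is NOT proved here (dimension 3: Cossart–Piltant 2008/2009 in print); counted 0.

* ★ `ThreeLines.dirStepUnobs_threeLines_of` — the certificate with the good parameter `c` and the two localisations `k[u][1/ℓ]`, `k[u][T][1/ℓ]`
  as arguments (chart/model bookkeeping: file 5b ✓ `…NatThreeLinesChartModel`).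
* ★ `ThreeLines.dirStepUnobs_threeLines` — for ANY blowing up `b : P̃ ⟶ ℙ³` of the vertex (`k` infinite): the union of the strict transforms of the
  three lines `V₊(x₁ − q₁x₀, x₂ − q₂x₀)`, `q ∈ {(0,0),(1,0),(0,1)}`, satisfies `DirStepUnobs P̃ univ _`.
* ★★ `dirStepUnobs_univ_iUnion_vertexLineStrict` — `DirStepUnobs P̃ Set.univ isClosed_univ (⋃ i : Fin 3, vertexLineStrict b i) hZ` for every blowing up
  `b` of the vertex and every closedness witness `hZ`; ★★ `Steiner.dirStepUnobs_univ_iUnion_vertexLineStrict` — the same in the currency of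
  ✓ `Steiner.noseHypPointsFirstBTriplePrime_of_unobs_of_final` (`υ : F₂ ⟶ SpecimenQuarticTcDelta.P3 k`, witness ✓ `Steiner.isClosed_iUnion_vertexLineStrict υ`).

References (index only): J. Lipman, Publ. Math. IHÉS 36 (1969), Prop. (1.2) A) p. 200 [cite: Lipman1969]; R. Hartshorne (1977), II §7, III.5
[cite: Hartshorne1977]; The Stacks Project, Tags 0804, 02OS, 01ED [cite: StacksProject]; A. J. de Jong (1996), proof of Lemma 4.11 [cite: DeJong1996].
-/

set_option linter.dupNamespace false -- mandated namespace `Summit.<Summit>.<Problem>` of this single-conjunct summit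

noncomputable section

-- `Proj`/`ProjectiveSpectrum` carrier coercions under `instances` transparency (as in the chain's other chart files).
set_option backward.isDefEq.respectTransparency false

open CategoryTheory AlgebraicGeometry TopologicalSpace HomogeneousLocalization Topology Opposite MvPolynomial
open Literature.AlgebraicGeometry.Resolution Literature.AlgebraicGeometry.Resolution.DeJong1996
open Literature.AlgebraicGeometry.Resolution.PointBlowup (Chart Base frac exc)
open Literature.AlgebraicGeometry.Motives.Segre (grading X_mem chartι toSpec)
open Literature.AlgebraicGeometry.Motives.RatFn
open AlgebraicGeometry.Scheme.IdealSheafData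

attribute [local instance] MvPolynomial.gradedAlgebra Literature.AlgebraicGeometry.Motives.ProjBaseChange.algebraBase
  Literature.AlgebraicGeometry.Motives.ProjBaseChange.isScalarTower_localization

namespace Summit.ResolutionOfSingularities.ResolutionOfSingularities.Cruxes.EquisingularLiftNat.Sections

variable {k : Type} [Field k]

namespace ThreeLines

/-! ## ★ The certificate for the three lines -/

set_option maxHeartbeats 900000 in
-- ONE ≈260-line assembly elaborated as a single declaration over large chart/section types (measured: 0.8 M heartbeats do not suffice,
-- 0.9 M do; kernel-cheap) — the same shape as ✓ `dirStepUnobs_univ_vertexLineStrict` (400000) with two charts read through two models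
/-- ★ **The three-line certificate, with the auxiliary localisations `L₂ = k[u][1/ℓ]`, `L = k[u][T][1/ℓ]` and the good parameter `c` as
arguments** (see `dirStepUnobs_threeLines`): for ANY blowing up `b : P̃ ⟶ ℙ³_k` of the vertex, the union of the strict transforms of the three
lines `V₊(x₁ − q₁x₀, x₂ − q₂x₀)`, `q ∈ {(0,0),(1,0),(0,1)}`, satisfies `DirStepUnobs P̃ univ _` — `Ȟ¹ = 0` for the normal sheaf of the reduced
union, certified on the two affine charts `c₀(Spec C₀) ∩ D(ℓ)`, `b⁻¹D₊(x₀) ∩ D(ℓ)` by ✓ `dirStepUnobs_univ_of_charts` (027's recipe: generators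
`f, g` of ✓ CI3 through the model, transition matrix `1`, Laurent splitting with coefficients in `k[u][1/ℓ]`).
[cite: Lipman1969, Proposition (1.2) A) (p. 200)] [OURS · L1 W4.5b · EL♮(3) · nose residue (c); NOT a statement of the manuscript] -/
theorem dirStepUnobs_threeLines_of {P : Scheme.{0}} (b : P ⟶ Proj (grading (Fin (2 + 1 + 1)) k)) (hb : IsBlowup b (vertexIdealSheaf 2 k))
    (c : k) (hc1 : c ≠ 1) (hc2 : c ≠ 2) (L₂ : Type) [CommRing L₂] [Algebra (MvPolynomial (Fin 2) k) L₂]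
    [IsLocalization.Away (X 1 + 1 + C c * (X 0 - 1) : MvPolynomial (Fin 2) k) L₂]
    (L : Type) [CommRing L] [Algebra (MvPolynomial Unit (MvPolynomial (Fin 2) k)) L]
    [IsLocalization.Away ((C (X 1 + 1 + C c * (X 0 - 1)) : MvPolynomial Unit (MvPolynomial (Fin 2) k))) L]
    (hZ : IsClosed (⋃ i : Fin (2 + 1), closure (b ⁻¹' ({y : Proj (grading (Fin (2 + 1 + 1)) k) |
        (X 1 - C ((![![0, 0], ![1, 0], ![0, 1]] : Fin (2 + 1) → Fin 2 → k) i 0) * X 0 : MvPolynomial (Fin (2 + 1 + 1)) k) ∈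
            y.asHomogeneousIdeal ∧
        (X 2 - C ((![![0, 0], ![1, 0], ![0, 1]] : Fin (2 + 1) → Fin 2 → k) i 1) * X 0 : MvPolynomial (Fin (2 + 1 + 1)) k) ∈
            y.asHomogeneousIdeal} \ {vertex 2 k})))) :
    DirStepUnobs P Set.univ isClosed_univ (⋃ i : Fin (2 + 1), closure (b ⁻¹' ({y : Proj (grading (Fin (2 + 1 + 1)) k) |
        (X 1 - C ((![![0, 0], ![1, 0], ![0, 1]] : Fin (2 + 1) → Fin 2 → k) i 0) * X 0 : MvPolynomial (Fin (2 + 1 + 1)) k) ∈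
            y.asHomogeneousIdeal ∧
        (X 2 - C ((![![0, 0], ![1, 0], ![0, 1]] : Fin (2 + 1) → Fin 2 → k) i 1) * X 0 : MvPolynomial (Fin (2 + 1 + 1)) k) ∈
            y.asHomogeneousIdeal} \ {vertex 2 k}))) hZ := by
  classical
  haveI : IsIntegral P := isIntegral_of_isBlowup_vertex hb
  haveI : IsDominant b := isDominant_of_isBlowup_vertex hb
  haveI : IsLocallyNoetherian P := Steiner.isLocallyNoetherian_of_isBlowup_vertex hb
  obtain ⟨cB, hcBo, hcB, hcBim⟩ := exists_lift_of_isBlowup_vertex b hb 0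
  obtain ⟨ΦA, hΦAT, hΦA0, hΦA1, hΦAc⟩ := exists_modelEquiv_chart (k := k)
  obtain ⟨ΦB, -, hΦB0, hΦB1, hΦBc⟩ := exists_modelEquiv_away (k := k)
  set ℓ : MvPolynomial (Fin 2) k := X 1 + 1 + C c * (X 0 - 1) with hℓ
  -- the section isomorphisms `θ_A : Γ(A) ≅ C₀`, `θ_B : Γ(B) ≅ (k[x]_{x₀})₀` of the two charts and the plane polynomials as sections `σ`
  -- (all kept OPAQUE with their defining equations: their bodies are large and must never be unfolded by unification)
  obtain ⟨θA, hθA⟩ : ∃ θ : Γ(P, vertexChart hb 0 ''ᵁ ⊤) ≃+* (CommRingCat.of (Chart 2 k 0) : CommRingCat.{0}),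
      θ = ((vertexChart hb 0).appIso ⊤ ≪≫ Scheme.ΓSpecIso (.of (Chart 2 k 0))).commRingCatIsoToRingEquiv := ⟨_, rfl⟩
  obtain ⟨θB, hθB⟩ : ∃ θ : Γ(P, cB ''ᵁ ⊤) ≃+*
      (CommRingCat.of (Away (grading (Fin (2 + 1 + 1)) k) (X (Fin.castSucc (0 : Fin (2 + 1))))) : CommRingCat.{0}),
      θ = (cB.appIso ⊤ ≪≫ Scheme.ΓSpecIso (.of _)).commRingCatIsoToRingEquiv := ⟨_, rfl⟩
  obtain ⟨σ, hσ⟩ : ∃ σ : MvPolynomial (Fin 2) k →+* Γ(P, lsChart (blowupRatFn b) 0), σ = MvPolynomial.eval₂Hom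
    ((P.presheaf.map (homOfLE (le_top : lsChart (blowupRatFn b) 0 ≤ ⊤)).op).hom.comp
      (((b ≫ toSpec (Fin (2 + 1 + 1)) k).appTop).hom.comp (Scheme.ΓSpecIso (.of k)).inv.hom))
    (fun j : Fin 2 => lsRatio (blowupRatFn b) 0 (Fin.succ j)) := ⟨_, rfl⟩
  have hσA : ∀ r, P.presheaf.map (homOfLE (image_top_le_lsChart b hb 0)).op (σ r) = θA.symm (ΦA (C r)) := fun r => by
    rw [RingEquiv.eq_symm_apply, hθA, hσ]
    exact chartRingEquiv_sigma_A b hb ΦA hΦA0 hΦA1 hΦAc r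
  have hσB : ∀ r, P.presheaf.map (homOfLE (image_top_le_lsChart_B 0 cB hcB)).op (σ r) = θB.symm (ΦB (C r)) := fun r => by
    rw [RingEquiv.eq_symm_apply, hθB, hσ]
    exact chartRingEquiv_sigma_B b cB hcB ΦB hΦB0 hΦB1 hΦBc r
  -- the two affine charts `U0 = A ∩ D(ℓ)`, `U1 = B ∩ D(ℓ)`
  set ℓA : Γ(P, vertexChart hb 0 ''ᵁ ⊤) := θA.symm (ΦA (C ℓ)) with hℓA
  set ℓB : Γ(P, cB ''ᵁ ⊤) := θB.symm (ΦB (C ℓ)) with hℓB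
  have hU0 : IsAffineOpen (P.basicOpen ℓA) := (isAffineOpen_image_top (vertexChart hb 0)).basicOpen ℓA
  have hU1 : IsAffineOpen (P.basicOpen ℓB) := (isAffineOpen_image_top cB).basicOpen ℓB
  have h0A : P.basicOpen ℓA ≤ vertexChart hb 0 ''ᵁ ⊤ := P.basicOpen_le ℓA
  have h1B : P.basicOpen ℓB ≤ cB ''ᵁ ⊤ := P.basicOpen_le ℓB
  -- the generators `f, g` restricted to the two charts, through the models
  set xA : Fin 2 → Γ(P, P.basicOpen ℓA) := ![P.presheaf.map (homOfLE (P.basicOpen_le (θA.symm (ΦA (C ℓ))))).op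
      (θA.symm (ΦA (C (X 0 * (X 0 - 1))))),
    P.presheaf.map (homOfLE (P.basicOpen_le (θA.symm (ΦA (C ℓ))))).op (θA.symm (ΦA (C (X 1 * (X 1 - 1 + 2 * X 0)))))] with hxA
  set xB : Fin 2 → Γ(P, P.basicOpen ℓB) := ![P.presheaf.map (homOfLE (P.basicOpen_le (θB.symm (ΦB (C ℓ))))).op
      (θB.symm (ΦB (C (X 0 * (X 0 - 1))))),
    P.presheaf.map (homOfLE (P.basicOpen_le (θB.symm (ΦB (C ℓ))))).op (θB.symm (ΦB (C (X 1 * (X 1 - 1 + 2 * X 0)))))] with hxB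
  -- the model maps `ψ_A : M → Γ(U0)`, `ψ_B : M → Γ(U1)`
  let ψA : MvPolynomial Unit (MvPolynomial (Fin 2) k) →+* Γ(P, P.basicOpen ℓA) :=
    ((P.presheaf.map (homOfLE (P.basicOpen_le ℓA)).op).hom.comp (θA.symm : _ →+* Γ(P, vertexChart hb 0 ''ᵁ ⊤))).comp
      (ΦA : MvPolynomial Unit (MvPolynomial (Fin 2) k) →+* Chart 2 k 0)
  let ψB : MvPolynomial Unit (MvPolynomial (Fin 2) k) →+* Γ(P, P.basicOpen ℓB) :=
    ((P.presheaf.map (homOfLE (P.basicOpen_le ℓB)).op).hom.comp (θB.symm : _ →+* Γ(P, cB ''ᵁ ⊤))).comp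
      (ΦB : MvPolynomial Unit (MvPolynomial (Fin 2) k) →+* Away (grading (Fin (2 + 1 + 1)) k) (X (Fin.castSucc (0 : Fin (2 + 1)))))
  have huA : IsUnit (ψA (C ℓ)) := P.toRingedSpace.isUnit_res_basicOpen ℓA
  have huB : IsUnit (ψB (C ℓ)) := P.toRingedSpace.isUnit_res_basicOpen ℓB
  -- chart preimages of `Z`
  have hpreA := preimage_vertexChart_threeLines b hb ΦA hΦA0 hΦA1 hΦAc
  have hpreB := preimage_lift_threeLines b cB hcB ΦB hΦB0 hΦB1 hΦBc
  -- `hI`: the generators generate `𝓘⟨Z⟩` on the two charts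
  have hIA : Ideal.span (Set.range xA) = (vanishingIdeal ⟨_, hZ⟩).ideal ⟨P.basicOpen ℓA, hU0⟩ := by
    refine (Eq.trans ?_ (map_inf_eq_map_span_of_isUnit c ψA huA).symm).trans
      (ideal_basicOpen_eq_map (vertexChart hb 0) θA hθA ⟨_, hZ⟩ ΦA _ (isRadical_map_inf₃ ΦA) hpreA ℓA).symm
    rw [Ideal.map_span, Set.image_pair, hxA, Theorems.RadicialJung.CleanModelsSuffice.GameState.range_pair]
    rfl
  have hIB : Ideal.span (Set.range xB) = (vanishingIdeal ⟨_, hZ⟩).ideal ⟨P.basicOpen ℓB, hU1⟩ := by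
    refine (Eq.trans ?_ (map_inf_eq_map_span_of_isUnit c ψB huB).symm).trans
      (ideal_basicOpen_eq_map cB θB hθB ⟨_, hZ⟩ ΦB _ (isRadical_map_inf₃ ΦB) hpreB ℓB).symm
    rw [Ideal.map_span, Set.image_pair, hxB, Theorems.RadicialJung.CleanModelsSuffice.GameState.range_pair]
    rfl
  -- `hqr`: the generators are quasi-regular (transport from the model localisation `M[1/ℓ]`, ✓ `isQuasiRegular_fg_localization`)
  have hqrA : IsQuasiRegular xA := isQuasiRegular_pair_of_model (isAffineOpen_image_top (vertexChart hb 0)) θA ΦA (C ℓ) _ _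
    (isQuasiRegular_fg_localization c L)
  have hqrB : IsQuasiRegular xB := isQuasiRegular_pair_of_model (isAffineOpen_image_top cB) θB ΦB (C ℓ) _ _
    (isQuasiRegular_fg_localization c L)
  -- the overlap `O = U0 ∩ U1 = D(t|_{U0})`, `t = b^*(x₀/x₃)|_A` (opaque `tA`)
  obtain ⟨tA, htA⟩ : ∃ tA : Γ(P, vertexChart hb 0 ''ᵁ ⊤),
      tA = P.presheaf.map (homOfLE (image_top_le_preimage_lastChart b hb 0)).op (blowupSection b 0) := ⟨_, rfl⟩
  have hAB : vertexChart hb 0 ''ᵁ ⊤ ⊓ cB ''ᵁ ⊤ = P.basicOpen tA := by rw [hcBim, image_top_inf_preimage_basicOpen_eq, htA]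
  have hDA : P.basicOpen ℓA = vertexChart hb 0 ''ᵁ ⊤ ⊓ P.basicOpen (σ ℓ) := by rw [hℓA, ← hσA ℓ, Scheme.basicOpen_res]
  have hDB : P.basicOpen ℓB = cB ''ᵁ ⊤ ⊓ P.basicOpen (σ ℓ) := by rw [hℓB, ← hσB ℓ, Scheme.basicOpen_res]
  have hO : P.basicOpen ℓA ⊓ P.basicOpen ℓB = P.basicOpen (P.presheaf.map (homOfLE h0A).op tA) := by
    rw [Scheme.basicOpen_res, ← hAB, hDA, hDB]
    apply le_antisymm
    · exact le_inf inf_le_left (le_inf (inf_le_left.trans inf_le_left) (inf_le_right.trans inf_le_left))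
    · exact le_inf inf_le_left (le_inf (inf_le_right.trans inf_le_right) (inf_le_left.trans inf_le_right))
  have h01 : IsAffineOpen (P.basicOpen ℓA ⊓ P.basicOpen ℓB) := by rw [hO]; exact hU0.basicOpen _
  have hO0 : P.basicOpen ℓA ⊓ P.basicOpen ℓB ≤ vertexChart hb 0 ''ᵁ ⊤ ⊓ cB ''ᵁ ⊤ := inf_le_inf h0A h1B
  have hηAB : genericPoint P ∈ vertexChart hb 0 ''ᵁ ⊤ ⊓ cB ''ᵁ ⊤ :=
    ⟨genericPoint_mem_image_top b hb 0, hcBim ▸ Literature.AlgebraicGeometry.Motives.RatFn.genericPoint_mem_preimage b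
      (Literature.AlgebraicGeometry.Motives.ProjSpace.genericPoint_mem_U (Fin.castSucc 0))⟩
  -- `t · w = 1` on the overlap (opaque `wB = b^*(x₃/x₀)|_B`)
  have hBle : cB ''ᵁ ⊤ ≤ b ⁻¹ᵁ (gensP 2 k).U (Fin.castSucc 0) := image_top_le_preimage_basicOpen 0 cB hcB
  obtain ⟨wB, hwB⟩ : ∃ wB : Γ(P, cB ''ᵁ ⊤), wB = P.presheaf.map (homOfLE hBle).op
      (b.app ((gensP 2 k).U (Fin.castSucc 0)) ((gensP 2 k).ratio (Fin.castSucc 0) (Fin.last (2 + 1)))) := ⟨_, rfl⟩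
  have hcwAB : P.presheaf.map (homOfLE (inf_le_left : vertexChart hb 0 ''ᵁ ⊤ ⊓ cB ''ᵁ ⊤ ≤ _)).op tA *
      P.presheaf.map (homOfLE (inf_le_right : vertexChart hb 0 ''ᵁ ⊤ ⊓ cB ''ᵁ ⊤ ≤ _)).op wB = 1 := by
    rw [htA, hwB, res_res, res_res]
    exact blowupSection_mul_ratio_eq_one b 0 (inf_le_left.trans (image_top_le_preimage_lastChart b hb 0)) (inf_le_right.trans hBle) hηAB
  have hcw : P.presheaf.map (homOfLE (inf_le_left : P.basicOpen ℓA ⊓ P.basicOpen ℓB ≤ _)).op (P.presheaf.map (homOfLE h0A).op tA) *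
      P.presheaf.map (homOfLE (inf_le_right : P.basicOpen ℓA ⊓ P.basicOpen ℓB ≤ _)).op (P.presheaf.map (homOfLE h1B).op wB) = 1 := by
    have h := congrArg (P.presheaf.map (homOfLE hO0).op) hcwAB
    rw [map_mul, map_one, res_res, res_res] at h
    rw [res_res, res_res]
    exact h
  -- every section over the overlap is `s| / t|^N`
  have hsurj : ∀ u : Γ(P, P.basicOpen ℓA ⊓ P.basicOpen ℓB), ∃ (s : Γ(P, P.basicOpen ℓA)) (N : ℕ),
      u * P.presheaf.map (homOfLE inf_le_left).op (P.presheaf.map (homOfLE h0A).op tA) ^ N =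
        P.presheaf.map (homOfLE inf_le_left).op s := by
    intro u
    letI := (P.presheaf.map (homOfLE (inf_le_left : P.basicOpen ℓA ⊓ P.basicOpen ℓB ≤ P.basicOpen ℓA)).op).hom.toAlgebra
    haveI := hU0.isLocalization_of_eq_basicOpen (P.presheaf.map (homOfLE h0A).op tA)
      (homOfLE (inf_le_left : P.basicOpen ℓA ⊓ P.basicOpen ℓB ≤ P.basicOpen ℓA)) hO
    obtain ⟨⟨s, ⟨_, N, rfl⟩⟩, hs⟩ := IsLocalization.surj (Submonoid.powers (P.presheaf.map (homOfLE h0A).op tA)) u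
    refine ⟨s, N, ?_⟩
    have hs' : u * (P.presheaf.map (homOfLE (inf_le_left : P.basicOpen ℓA ⊓ P.basicOpen ℓB ≤ P.basicOpen ℓA)).op).hom
        ((P.presheaf.map (homOfLE h0A).op tA) ^ N) = (P.presheaf.map (homOfLE inf_le_left).op).hom s := hs
    rwa [map_pow] at hs'
  -- the two model sections agree on the overlap (transition matrix `1`)
  have hagreeC : ∀ r : MvPolynomial (Fin 2) k,
      P.presheaf.map (homOfLE (inf_le_left : P.basicOpen ℓA ⊓ P.basicOpen ℓB ≤ _)).op
          (P.presheaf.map (homOfLE h0A).op (θA.symm (ΦA (C r)))) =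
        P.presheaf.map (homOfLE (inf_le_right : P.basicOpen ℓA ⊓ P.basicOpen ℓB ≤ _)).op
          (P.presheaf.map (homOfLE h1B).op (θB.symm (ΦB (C r)))) := fun r => by
    rw [← hσA r, ← hσB r]
    simp only [res_res]
  have hagree : ∀ m, P.presheaf.map (homOfLE (inf_le_left : P.basicOpen ℓA ⊓ P.basicOpen ℓB ≤ _)).op (xA m) =
      P.presheaf.map (homOfLE (inf_le_right : P.basicOpen ℓA ⊓ P.basicOpen ℓB ≤ _)).op (xB m) := by
    intro m
    fin_cases m
    · exact hagreeC _
    · exact hagreeC _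
  -- the model localisations `Γ(U0) ≅ M[1/ℓ] = L ≅ Γ(U1)` (opaque) and the constants `L₂ = k[u][1/ℓ] → L → Γ(U0), Γ(U1)`
  obtain ⟨θℓA, hθℓA'⟩ : ∃ e : Γ(P, P.basicOpen ℓA) ≃+* L, ∀ r : MvPolynomial Unit (MvPolynomial (Fin 2) k),
      e.symm (algebraMap _ L r) = P.presheaf.map (homOfLE h0A).op (θA.symm (ΦA r)) :=
    exists_modelLocalization (isAffineOpen_image_top (vertexChart hb 0)) θA ΦA (C ℓ)
  obtain ⟨θℓB, hθℓB'⟩ : ∃ e : Γ(P, P.basicOpen ℓB) ≃+* L, ∀ r : MvPolynomial Unit (MvPolynomial (Fin 2) k),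
      e.symm (algebraMap _ L r) = P.presheaf.map (homOfLE h1B).op (θB.symm (ΦB r)) :=
    exists_modelLocalization (isAffineOpen_image_top cB) θB ΦB (C ℓ)
  obtain ⟨κL, hκL, hκL'⟩ : ∃ κ : L₂ →+* L, κ = IsLocalization.Away.map L₂ L
      (C : MvPolynomial (Fin 2) k →+* MvPolynomial Unit (MvPolynomial (Fin 2) k)) ℓ ∧
      ∀ r : MvPolynomial (Fin 2) k, κ (algebraMap _ L₂ r) = algebraMap _ L (C r) :=
    ⟨_, rfl, fun r => IsLocalization.map_eq _ r⟩
  let κ₀ : L₂ →+* Γ(P, P.basicOpen ℓA) := (θℓA.symm : L →+* Γ(P, P.basicOpen ℓA)).comp κL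
  let κ₁ : L₂ →+* Γ(P, P.basicOpen ℓB) := (θℓB.symm : L →+* Γ(P, P.basicOpen ℓB)).comp κL
  -- (no `set` from here on and rewriting by `simp only`: a failed unification between `A`-side and `B`-side terms, or against the body of
  -- `σ`, makes `rw`/`set` unfold the opens of `P`; at reducible transparency the mismatch is cheap)
  have hκ : ∀ a, P.presheaf.map (homOfLE (inf_le_left : P.basicOpen ℓA ⊓ P.basicOpen ℓB ≤ _)).op (κ₀ a) =
      P.presheaf.map (homOfLE (inf_le_right : P.basicOpen ℓA ⊓ P.basicOpen ℓB ≤ _)).op (κ₁ a) := by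
    have hext : (P.presheaf.map (homOfLE (inf_le_left : P.basicOpen ℓA ⊓ P.basicOpen ℓB ≤ _)).op).hom.comp κ₀ =
        (P.presheaf.map (homOfLE (inf_le_right : P.basicOpen ℓA ⊓ P.basicOpen ℓB ≤ _)).op).hom.comp κ₁ := by
      apply IsLocalization.ringHom_ext (Submonoid.powers ℓ)
      refine RingHom.ext fun r => ?_
      have eA : P.presheaf.map (homOfLE (inf_le_left : P.basicOpen ℓA ⊓ P.basicOpen ℓB ≤ _)).op (κ₀ (algebraMap _ L₂ r)) =
          P.presheaf.map (homOfLE (inf_le_left : P.basicOpen ℓA ⊓ P.basicOpen ℓB ≤ _)).op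
            (P.presheaf.map (homOfLE h0A).op (θA.symm (ΦA (C r)))) := by
        simp only [κ₀, RingHom.comp_apply, RingHom.coe_coe, hκL', hθℓA']
      have eB : P.presheaf.map (homOfLE (inf_le_right : P.basicOpen ℓA ⊓ P.basicOpen ℓB ≤ _)).op (κ₁ (algebraMap _ L₂ r)) =
          P.presheaf.map (homOfLE (inf_le_right : P.basicOpen ℓA ⊓ P.basicOpen ℓB ≤ _)).op
            (P.presheaf.map (homOfLE h1B).op (θB.symm (ΦB (C r)))) := by
        simp only [κ₁, RingHom.comp_apply, RingHom.coe_coe, hκL', hθℓB']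
      exact eA.trans ((hagreeC r).trans eB.symm)
    intro a
    exact RingHom.congr_fun hext a
  -- every section on `U0` is a polynomial in `t|` with coefficients from `κ₀` (EXACTLY), ✓ `exists_polynomial_eq_localization`
  have haX : (θℓA.symm : L →+* Γ(P, P.basicOpen ℓA)) (algebraMap (MvPolynomial Unit (MvPolynomial (Fin 2) k)) L (X ())) =
      P.presheaf.map (homOfLE h0A).op tA := by
    simp only [RingHom.coe_coe, hθℓA', hΦAT, htA]
    congr 1
    rw [RingEquiv.symm_apply_eq, hθA]
    exact (chartRingEquiv_blowupSection b hb 0).symm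
  have hT : ∀ s : Γ(P, P.basicOpen ℓA), ∃ p : Polynomial L₂,
      s - p.eval₂ κ₀ (P.presheaf.map (homOfLE h0A).op tA) ∈ (vanishingIdeal ⟨_, hZ⟩).ideal ⟨P.basicOpen ℓA, hU0⟩ := by
    intro s
    obtain ⟨p, hp⟩ := exists_polynomial_eq_localization c L₂ L (θℓA s)
    refine ⟨p, ?_⟩
    have hs : s = p.eval₂ κ₀ (P.presheaf.map (homOfLE h0A).op tA) := by
      calc s = θℓA.symm (θℓA s) := (θℓA.symm_apply_apply s).symm
        _ = θℓA.symm (p.eval₂ κL (algebraMap (MvPolynomial Unit (MvPolynomial (Fin 2) k)) L (X ()))) := by rw [hp, hκL]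
        _ = (θℓA.symm : L →+* Γ(P, P.basicOpen ℓA)) (p.eval₂ κL (algebraMap (MvPolynomial Unit (MvPolynomial (Fin 2) k)) L (X ()))) :=
            (congrFun (RingHom.coe_coe θℓA.symm) _).symm
        _ = p.eval₂ κ₀ ((θℓA.symm : L →+* Γ(P, P.basicOpen ℓA)) (algebraMap (MvPolynomial Unit (MvPolynomial (Fin 2) k)) L (X ()))) :=
            Polynomial.hom_eval₂ p κL _ _
        _ = p.eval₂ κ₀ (P.presheaf.map (homOfLE h0A).op tA) := by rw [haX]
    rw [hs, sub_self]
    exact Ideal.zero_mem _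
  -- ASSEMBLY
  refine dirStepUnobs_univ_of_charts P _ hZ ![⟨P.basicOpen ℓA, hU0⟩, ⟨P.basicOpen ℓB, hU1⟩] h01 ?_ (Fin.cons xA (Fin.cons xB finZeroElim))
    (Fin.forall_fin_two.mpr ⟨hqrA, hqrB⟩) (Fin.forall_fin_two.mpr ⟨hIA, hIB⟩) (fun m j => if m = j then 1 else 0) ?_ ?_
  · -- cover: a point of `Lᵢ′` in the chart `A` (resp. `B`) lies in `D(ℓ)` since `ℓ ≡ ℓ(qᵢ) ≠ 0` there
    exact threeLines_subset_union b hb cB hcB c hc1 hc2 θA hθA ΦA hΦA0 hΦA1 hΦAc hcBim θB hθB ΦB hΦB0 hΦB1 hΦBc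
  · -- transition matrix `1`
    intro m
    simp only [ite_mul, one_mul, zero_mul, Finset.sum_ite_eq, Finset.mem_univ, if_true]
    exact hagree m
  · -- the twisted splitting modulo `𝓘⟨Z⟩` (Lipman's Laurent argument ✓ `exists_split_mod`)
    intro cO
    have hsplit := fun m => exists_split_mod (Z := P) (inf_le_left : P.basicOpen ℓA ⊓ P.basicOpen ℓB ≤ _)
      (inf_le_right : P.basicOpen ℓA ⊓ P.basicOpen ℓB ≤ _) (P.presheaf.map (homOfLE h0A).op tA)
      (P.presheaf.map (homOfLE h1B).op wB) hcw ((vanishingIdeal ⟨_, hZ⟩).ideal ⟨P.basicOpen ℓA, hU0⟩)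
      ((vanishingIdeal ⟨_, hZ⟩).ideal ⟨P.basicOpen ℓA ⊓ P.basicOpen ℓB, h01⟩)
      (Scheme.IdealSheafData.map_ideal _ (show (⟨P.basicOpen ℓA ⊓ P.basicOpen ℓB, h01⟩ : P.affineOpens) ≤
        ⟨P.basicOpen ℓA, hU0⟩ from fun x hx => hx.1)).le
      κ₀ κ₁ hκ hsurj hT (cO m)
    choose v₀ v₁ hv using hsplit
    refine ⟨Fin.cons v₀ (Fin.cons v₁ finZeroElim), fun m => ?_⟩
    simp only [ite_mul, one_mul, zero_mul, Finset.sum_ite_eq, Finset.mem_univ, if_true]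
    exact hv m

/-- ★ **The union of the strict transforms of the three lines `V₊(x₁ − q₁x₀, x₂ − q₂x₀)`, `q ∈ {(0,0),(1,0),(0,1)}`, under ANY blowing up
`b : P̃ ⟶ ℙ³_k` of the vertex is UNOBSTRUCTED** (`k` infinite): `DirStepUnobs P̃ univ (⋃ᵢ Lᵢ′)` (★ `dirStepUnobs_threeLines_of` with 027's good
parameter `c ∉ {1, 2}` ✓ `ThreePointsCI.exists_good_c` and the localisations `k[u][1/ℓ]`, `k[u][T][1/ℓ]`).
[cite: Lipman1969, Proposition (1.2) A) (p. 200)] [OURS · L1 W4.5b · EL♮(3) · nose residue (c); NOT a statement of the manuscript] -/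
theorem dirStepUnobs_threeLines [Infinite k] {P : Scheme.{0}} (b : P ⟶ Proj (grading (Fin (2 + 1 + 1)) k))
    (hb : IsBlowup b (vertexIdealSheaf 2 k)) (hZ : IsClosed (⋃ i : Fin (2 + 1), closure (b ⁻¹' ({y : Proj (grading (Fin (2 + 1 + 1)) k) |
        (X 1 - C ((![![0, 0], ![1, 0], ![0, 1]] : Fin (2 + 1) → Fin 2 → k) i 0) * X 0 : MvPolynomial (Fin (2 + 1 + 1)) k) ∈
            y.asHomogeneousIdeal ∧
        (X 2 - C ((![![0, 0], ![1, 0], ![0, 1]] : Fin (2 + 1) → Fin 2 → k) i 1) * X 0 : MvPolynomial (Fin (2 + 1 + 1)) k) ∈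
            y.asHomogeneousIdeal} \ {vertex 2 k})))) :
    DirStepUnobs P Set.univ isClosed_univ (⋃ i : Fin (2 + 1), closure (b ⁻¹' ({y : Proj (grading (Fin (2 + 1 + 1)) k) |
        (X 1 - C ((![![0, 0], ![1, 0], ![0, 1]] : Fin (2 + 1) → Fin 2 → k) i 0) * X 0 : MvPolynomial (Fin (2 + 1 + 1)) k) ∈
            y.asHomogeneousIdeal ∧
        (X 2 - C ((![![0, 0], ![1, 0], ![0, 1]] : Fin (2 + 1) → Fin 2 → k) i 1) * X 0 : MvPolynomial (Fin (2 + 1 + 1)) k) ∈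
            y.asHomogeneousIdeal} \ {vertex 2 k}))) hZ := by
  obtain ⟨c, hc1, hc2⟩ := ThreePointsCI.exists_good_c (k := k)
  exact dirStepUnobs_threeLines_of b hb c hc1 hc2 (Localization.Away (X 1 + 1 + C c * (X 0 - 1) : MvPolynomial (Fin 2) k))
    (Localization.Away ((C (X 1 + 1 + C c * (X 0 - 1)) : MvPolynomial Unit (MvPolynomial (Fin 2) k)))) hZ

end ThreeLines

/-! ## ★★ The `hunobs` input of «Steiner ∈ ν2» -/

/-- ★★ **`DirStepUnobs P̃ univ (⋃ i : Fin 3, vertexLineStrict b i)` for every blowing up `b : P̃ ⟶ ℙ³_k` of the vertex** (`k` infinite) and every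
closedness witness `hZ`: after the linear automorphism of ✓ `ThreeLines.exists_linearAut` (which fixes the vertex and carries the three coordinate
lines `V₊(x_j : j ≠ i, 3)` to `V₊(x₁ − q₁x₀, x₂ − q₂x₀)`, `q ∈ {(0,0),(1,0),(0,1)}`), this is ★ `ThreeLines.dirStepUnobs_threeLines` for the blowing up
`b ≫ ψ⁻¹` (✓ `isBlowup_comp_inv`, ✓ `vertexLineStrict_eq_closure_preimage`, ✓ `dirStepUnobs_congr_set`).
[cite: Lipman1969, Proposition (1.2) A) (p. 200)] [OURS · L1 W4.5b · EL♮(3) · nose residue (c) = D3-9′ ×3 union; NOT a statement of the manuscript;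
resolution in char p NOT proved here] -/
theorem dirStepUnobs_univ_iUnion_vertexLineStrict [Infinite k] {P : Scheme.{0}} (b : P ⟶ Proj (grading (Fin (2 + 1 + 1)) k))
    (hb : IsBlowup b (vertexIdealSheaf 2 k)) (hZ : IsClosed (⋃ i : Fin 3, vertexLineStrict b i)) :
    DirStepUnobs P Set.univ isClosed_univ (⋃ i : Fin 3, vertexLineStrict b i) hZ := by
  obtain ⟨ψ, hψv, hψ⟩ := ThreeLines.exists_linearAut (k := k)
  have heq : (⋃ i : Fin 3, vertexLineStrict b i) = ⋃ i : Fin (2 + 1), closure ((b ≫ ψ.inv) ⁻¹' ({y : Proj (grading (Fin (2 + 1 + 1)) k) |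
      (X 1 - C ((![![0, 0], ![1, 0], ![0, 1]] : Fin (2 + 1) → Fin 2 → k) i 0) * X 0 : MvPolynomial (Fin (2 + 1 + 1)) k) ∈
          y.asHomogeneousIdeal ∧
      (X 2 - C ((![![0, 0], ![1, 0], ![0, 1]] : Fin (2 + 1) → Fin 2 → k) i 1) * X 0 : MvPolynomial (Fin (2 + 1 + 1)) k) ∈
          y.asHomogeneousIdeal} \ {vertex 2 k})) :=
    Set.iUnion_congr fun i => ThreeLines.vertexLineStrict_eq_closure_preimage ψ hψv hψ b i
  exact (dirStepUnobs_congr_set (hZ' := heq ▸ hZ) heq).mpr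
    (ThreeLines.dirStepUnobs_threeLines (b ≫ ψ.inv) (ThreeLines.isBlowup_comp_inv ψ hψv b hb) (heq ▸ hZ))

namespace Steiner

/-- ★★ **CLAUSE (c) of «Steiner ∈ ν2» — the `hunobs` hypothesis of ✓ `Steiner.noseHypPointsFirstBTriplePrime_of_unobs_of_final`, BY TYPE**:
`DirStepUnobs F₂ Set.univ isClosed_univ (⋃ i : Fin 3, vertexLineStrict υ i) (isClosed_iUnion_vertexLineStrict υ)` for every blowing up
`υ : F₂ ⟶ ℙ³` of the triple point of Steiner's Roman surface (`k` infinite, e.g. `k = k̄`).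
[OURS · L1 W4.5b · EL♮(3) · nose, clause (c); NOT a statement of the manuscript; EL♮(3) NOT proved; resolution in char p NOT proved here] -/
theorem dirStepUnobs_univ_iUnion_vertexLineStrict [Infinite k] {F₂ : Scheme.{0}} {υ : F₂ ⟶ SpecimenQuarticTcDelta.P3 k}
    (hυ : IsBlowup υ (vertexIdealSheaf 2 k)) :
    DirStepUnobs F₂ Set.univ isClosed_univ (⋃ i : Fin 3, vertexLineStrict υ i) (isClosed_iUnion_vertexLineStrict υ) :=
  Sections.dirStepUnobs_univ_iUnion_vertexLineStrict υ hυ _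

end Steiner

end Summit.ResolutionOfSingularities.ResolutionOfSingularities.Cruxes.EquisingularLiftNat.Sections

end
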